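import Mathlib.Algebra.CharP.Lemmas
import Literature.RingTheory.TightClosure.TightClosure
import HarnessLib

/-!
# Power step for tight closure under colon capturing
(crux `FrobeniusLadder.FRationalResolution`, line `Sketch`)

Stub `stub_tc_power_step_cc` (cycle 4, theme C, worker C1) of the skeleton `Sketch` for crux
stmt-ResolutionOfSingularities-15317. Theme C proves, for quotients `R = S/Q` of regular local rings
and WITHOUT a Cohen–Macaulay hypothesis, that ONE tightly closed system-of-parameters ideal forces all
of them to be tightly closed (cf. [HochsterHuneke1994, Thm. 4.2 (d), Prop. 6.27 (a)]). This file is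
the POWER STEP "`(J, a)` tightly closed ⇒ `(J, a^M)` tightly closed for `M ≥ 1`", the variant of the
sibling `stub_tc_power_step` (file `…TightClosurePowerStep`) in which the hypothesis "`a` is a
non-zero-divisor modulo every Frobenius power `J^[p^e]`" is replaced by COLON CAPTURING WITH A UNIFORM
MULTIPLIER: there are a fixed `c ∈ R°` and a fixed `N : ℕ` such that `z a^m ∈ J^[p^e]` with `m > 0`
implies `c z^(p^N) ∈ J^[p^(e+N)]`.

Proof (induction on `M ≥ 1`; `M = 1` is the hypothesis). For the step `M → M + 1` (`M ≥ 1`) let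
`u ∈ (J, a^(M+1))^*` with witnesses `c_u ∈ R°`, `e₀`. As `(J, a^(M+1)) ⊆ (J, a^M)` and the latter is
tightly closed by induction, `u = j + r a^M` with `j ∈ J`. For `e ≥ e₀`, `q = p^e`:
`(J, b)^[q] = J^[q] + (b^q)` (both sides are the extension of `(J, b)` along the `e`-th iterate of the
Frobenius), so `c_u u^q = c_u j^q + c_u r^q a^(Mq) = j' + s a^((M+1)q)` with `j' ∈ J^[q]`, i.e.
`(c_u r^q - s a^q) a^(Mq) = j' - c_u j^q ∈ J^[q]`. Colon capturing (`Mq > 0`) gives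
`c (c_u r^q - s a^q)^(p^N) ∈ J^[p^(e+N)]`, and by Frobenius
`(c_u r^q - s a^q)^(p^N) = c_u^(p^N) r^(p^(e+N)) - s^(p^N) a^(p^(e+N))`, whence
`(c c_u^(p^N)) r^(p^(e+N)) ∈ J^[p^(e+N)] + (a^(p^(e+N))) = (J, a)^[p^(e+N)]`. With the FIXED multiplier
`d = c c_u^(p^N) ∈ R°` and the threshold `e₀ + N` this says `r ∈ (J, a)^* = (J, a)`, so
`r = j'' + t a` and `u = (j + j'' a^M) + t a^(M+1) ∈ (J, a^(M+1))`.
-/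

-- single-problem summit: the doubled namespace component is forced
set_option linter.dupNamespace false

namespace Summit.ResolutionOfSingularities.ResolutionOfSingularities.Theorems.FRationalResolution

open IsLocalRing Literature.RingTheory.TightClosure

/-- STUB (worker C1) — **POWER STEP FOR TIGHT CLOSURE UNDER COLON CAPTURING.** In a ring of prime
characteristic `p`, let `J` be an ideal and `a ∈ R`, and assume colon capturing with a uniform
multiplier: for fixed `c ∈ R°` and `N : ℕ`, `z a^m ∈ J^[p^e]` with `m > 0` implies
`c z^(p^N) ∈ J^[p^(e+N)]`. If `(J, a)` is tightly closed then so is `(J, a^M)` for every `M ≥ 1`.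
Induction on `M`: `u ∈ (J, a^(M+1))^* ⊆ (J, a^M)^* = (J, a^M)`, `u = j + r a^M`; then
`(c_u rᵠ − s aᵠ) a^(Mq) ∈ J^[q]` for `q = p^e ≫ 0`; colon capturing and the Frobenius give
`(c c_u^P) r^(qP) ∈ J^[qP] + (a^(qP)) = (J, a)^[qP]` (`P = p^N`), so `r ∈ (J, a)^* = (J, a)` and
`u ∈ (J, a^(M+1))`. [folklore; cf. HochsterHuneke1994, proofs of Thm. 4.2 (d) and Prop. 6.27 (a)] -/
theorem stub_tc_power_step_cc (p : ℕ) [Fact p.Prime] (R : Type) [CommRing R] [CharP R p]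
    (J : Ideal R) (a c : R) (hc : c ∈ Literature.RingTheory.TightClosure.minimalPrimesCompl R) (N : ℕ)
    (hcc : ∀ (e m : ℕ) (z : R), 0 < m →
      z * a ^ m ∈ Literature.RingTheory.TightClosure.frobeniusPower (p ^ e) J →
      c * z ^ p ^ N ∈ Literature.RingTheory.TightClosure.frobeniusPower (p ^ (e + N)) J)
    (htc : Literature.RingTheory.TightClosure.IsTightlyClosed p (J ⊔ Ideal.span {a})) (M : ℕ)
    (hM : 0 < M) :
    Literature.RingTheory.TightClosure.IsTightlyClosed p (J ⊔ Ideal.span {a ^ M}) := by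
  -- Frobenius powers of `I + (b)`: `(I + (b))^[p^e] = I^[p^e] + (b^(p^e))`
  have hsup : ∀ (e : ℕ) (I : Ideal R) (b : R), frobeniusPower (p ^ e) (I ⊔ Ideal.span {b}) =
      frobeniusPower (p ^ e) I ⊔ Ideal.span {b ^ p ^ e} := fun e I b => by
    rw [frobeniusPower_eq_map_iterateFrobenius, Ideal.map_sup, Ideal.map_span, Set.image_singleton,
      iterateFrobenius_def, ← frobeniusPower_eq_map_iterateFrobenius]
  induction M with
  | zero => exact absurd hM (lt_irrefl 0)
  | succ M ih =>
    -- `M + 1 = 1`: this is the hypothesis `htc`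
    rcases Nat.eq_zero_or_pos M with rfl | hMpos
    · rw [zero_add, pow_one]
      exact htc
    replace ih := ih hMpos
    rw [isTightlyClosed_iff_le]
    intro u hu
    obtain ⟨cu, hcu, e₀, he⟩ := (mem_tightClosure_iff p).mp hu
    -- `(J, a^(M+1)) ⊆ (J, a^M)`, so `u ∈ (J, a^M)^* = (J, a^M)` by the induction hypothesis
    have hle : J ⊔ Ideal.span {a ^ (M + 1)} ≤ J ⊔ Ideal.span {a ^ M} :=
      sup_le_sup_left (Ideal.span_singleton_le_span_singleton.mpr ⟨a, pow_succ a M⟩) _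
    have huM : u ∈ J ⊔ Ideal.span {a ^ M} := ih.le (tightClosure_mono p hle hu)
    obtain ⟨j, hj, r', hr', hju⟩ := Submodule.mem_sup.mp huM
    obtain ⟨r, rfl⟩ := Ideal.mem_span_singleton'.mp hr'
    -- `r ∈ (J, a)^*`, with the fixed multiplier `c * cu^(p^N)` and the threshold `e₀ + N`
    have hr : r ∈ tightClosure p (J ⊔ Ideal.span {a}) := by
      refine (mem_tightClosure_iff p).mpr
        ⟨c * cu ^ p ^ N, mul_mem hc (pow_mem hcu _), e₀ + N, fun E hE => ?_⟩
      -- write `E = e + N` with `e ≥ e₀`, `q = p^e`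
      obtain ⟨e, rfl⟩ : ∃ e, E = e + N := ⟨E - N, by omega⟩
      have hee : e₀ ≤ e := by omega
      have h1 := he e hee
      rw [hsup e J (a ^ (M + 1))] at h1
      rw [hsup (e + N) J a]
      obtain ⟨j', hj', s', hs', hjs⟩ := Submodule.mem_sup.mp h1
      obtain ⟨s, rfl⟩ := Ideal.mem_span_singleton'.mp hs'
      -- `cu u^q = cu j^q + cu r^q a^(Mq) = j' + s a^((M+1)q)`
      have hupow : u ^ p ^ e = j ^ p ^ e + r ^ p ^ e * (a ^ M) ^ p ^ e := by
        rw [← hju, add_pow_expChar_pow, mul_pow]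
      have hjq : cu * j ^ p ^ e ∈ frobeniusPower (p ^ e) J :=
        Ideal.mul_mem_left _ _ (pow_mem_frobeniusPower hj)
      have hkey : (cu * r ^ p ^ e - s * a ^ p ^ e) * a ^ (M * p ^ e) ∈
          frobeniusPower (p ^ e) J := by
        have h2 : (cu * r ^ p ^ e - s * a ^ p ^ e) * a ^ (M * p ^ e) = j' - cu * j ^ p ^ e := by
          have hj'eq : j' = cu * u ^ p ^ e - s * (a ^ (M + 1)) ^ p ^ e := by
            rw [← hjs]; ring
          rw [hj'eq, hupow]
          ring
        rw [h2]
        exact sub_mem hj' hjq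
      -- colon capturing (`M q > 0`): `c (cu r^q - s a^q)^(p^N) ∈ J^[p^(e+N)]`
      have h3 : c * (cu * r ^ p ^ e - s * a ^ p ^ e) ^ p ^ N ∈ frobeniusPower (p ^ (e + N)) J :=
        hcc e (M * p ^ e) _ (mul_pos hMpos (expChar_pow_pos R p e)) hkey
      -- Frobenius: `(cu r^q - s a^q)^(p^N) = cu^(p^N) r^(p^(e+N)) - s^(p^N) a^(p^(e+N))`
      have hrpow : (r ^ p ^ e) ^ p ^ N = r ^ p ^ (e + N) := by rw [← pow_mul, ← pow_add]
      have hapow : (a ^ p ^ e) ^ p ^ N = a ^ p ^ (e + N) := by rw [← pow_mul, ← pow_add]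
      have h4 : (cu * r ^ p ^ e - s * a ^ p ^ e) ^ p ^ N =
          cu ^ p ^ N * r ^ p ^ (e + N) - s ^ p ^ N * a ^ p ^ (e + N) := by
        rw [sub_pow_expChar_pow, mul_pow, mul_pow, hrpow, hapow]
      have h5 : c * cu ^ p ^ N * r ^ p ^ (e + N) =
          c * (cu * r ^ p ^ e - s * a ^ p ^ e) ^ p ^ N + c * s ^ p ^ N * a ^ p ^ (e + N) := by
        rw [h4]; ring
      rw [h5]
      exact add_mem (Ideal.mem_sup_left h3)
        (Ideal.mem_sup_right (Ideal.mem_span_singleton'.mpr ⟨c * s ^ p ^ N, rfl⟩))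
    -- `r ∈ (J, a)`, so `u = j + r a^M ∈ (J, a^(M+1))`
    have hrJ : r ∈ J ⊔ Ideal.span {a} := htc.le hr
    obtain ⟨j'', hj'', t', ht', hjt⟩ := Submodule.mem_sup.mp hrJ
    obtain ⟨t, rfl⟩ := Ideal.mem_span_singleton'.mp ht'
    rw [← hju, ← hjt]
    have h6 : j + (j'' + t * a) * a ^ M = (j + a ^ M * j'') + t * a ^ (M + 1) := by ring
    rw [h6]
    exact add_mem (Ideal.mem_sup_left (add_mem hj (Ideal.mul_mem_left _ _ hj'')))
      (Ideal.mem_sup_right (Ideal.mem_span_singleton'.mpr ⟨t, rfl⟩))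

end Summit.ResolutionOfSingularities.ResolutionOfSingularities.Theorems.FRationalResolution
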